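import Literature.Algebra.Lie.ChevalleyEilenbergPostComposition
import Literature.Algebra.Lie.ChevalleyEilenbergScalars
import HarnessLib

/-!
# The wedge `α ∧ f` of a `1`-form with Chevalley–Eilenberg cochains

Topic `Algebra/Lie`; namespace `Literature.Algebra.Lie.ChevalleyEilenberg` (the recursive Cartan
calculus of `ChevalleyEilenbergComplex`: cochains `Cochain R L M q = L [⋀^Fin q]→ₗ[R] M`, insertions
`ins`, Lie derivative `lieDer`, differential `d`, changes of pair `pull` / `post`, group actions
`PairAction.act`, the relative and `(𝔤, K)`-subcomplexes `Subcomplex.rel` / `Subcomplex.gK`).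
Definitions with bodies and theorems; no named fact, no `sorry`.

For a linear form `α : L →ₗ[R] R` (a `1`-cochain with trivial coefficients) we construct the
**wedge** `α ∧ f ∈ C^{q+1}(L; M)` of `α` with a cochain `f ∈ C^q(L; M)`,
`(α ∧ f)(x₀, …, x_q) = ∑ᵢ (-1)ⁱ α(xᵢ) f(x₀, …, x̂ᵢ, …, x_q)`, in the style of the file
`ChevalleyEilenbergComplex` — by recursion on the degree through its contraction rule

* `ins_wedgeOne_succ` / `ins_wedgeOne_zero` — `i_y (α ∧ f) = α(y) f - α ∧ (i_y f)` (and
  `i_y (α ∧ f) = α(y) f` in degree `0`),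

and prove the identities of the Cartan calculus that a CENTRAL SPLITTING uses
[cite: BorelWallach2000, I §1.3] (`H^•(𝔤, K; V) = H^•(𝔪, K; V) ⊗ Λ^• 𝔞^*` for `𝔤 = 𝔪 ⊕ 𝔞` with `𝔞`
central acting trivially: the classes `α ∧ η`, `α ∈ 𝔞^*`):

* `post_wedgeOne`, `pull_wedgeOne` — naturality in the coefficients and under changes of Lie pair
  (`(φ, ψ)^*(α ∧ f) = (α ∘ φ) ∧ (φ, ψ)^* f`), hence `act_wedgeOne` — `g • (α ∧ f) = α ∧ (g • f)` for a
  pair action fixing `α`;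
* `lieDer_wedgeOne` — `θ_x (α ∧ f) = α ∧ θ_x f` when `α` vanishes on brackets (`θ_x α = 0`);
* `d_wedgeOne` — **`d (α ∧ f) = -(α ∧ d f)`** when `α` vanishes on brackets (`dα = 0`; the sign is
  that of the recursion `i_y d = θ_y - d i_y` of the tree's `d`);
* `wedgeOne_mem_rel`, `wedgeOne_mem_gK` — `α ∧ f` is a relative / `(𝔤, K)`-cochain when `f` is, for
  `α` vanishing on `𝔨` and on brackets and fixed by `K`.

## References

* A. Borel, N. Wallach, *Continuous cohomology, discrete subgroups, and representations of reductive
  groups*, 2nd ed., AMS 2000, I §1.1 (Cartan calculus), I §1.3 (central splitting). [BorelWallach2000]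
* C. Chevalley, S. Eilenberg, *Cohomology theory of Lie groups and Lie algebras*, Trans. AMS 63
  (1948), §23 (23.4)–(23.6) (the recursions), §24 (cup products). [ChevalleyEilenberg1948]
-/

namespace Literature.Algebra.Lie.ChevalleyEilenberg

variable {R : Type*} [CommRing R] {L : Type*} [LieRing L] [LieAlgebra R L]
  {M : Type*} [AddCommGroup M] [Module R M] (α : L →ₗ[R] R)

/-! ### Construction by recursion on the degree -/

section Construction

/-- The linear map `y ↦ α(y) f - W (i_y f)` (to be uncurried into `α ∧ f`, `W` being the wedge in
the degree below). [cite: ChevalleyEilenberg1948, §23 (23.4)] -/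
def wedgeFun (q : ℕ) (W : Cochain R L M q →ₗ[R] Cochain R L M (q + 1)) (f : Cochain R L M (q + 1)) :
    L →ₗ[R] Cochain R L M (q + 1) :=
  α.smulRight f - W ∘ₗ ((AlternatingMap.curryLeftLinearMap (R := R) (n := q)) f)

/-- Unfolding of `wedgeFun`. [folklore] -/
@[simp] theorem wedgeFun_apply (q : ℕ) (W : Cochain R L M q →ₗ[R] Cochain R L M (q + 1))
    (f : Cochain R L M (q + 1)) (y : L) : wedgeFun α q W f y = α y • f - W (ins q y f) := rfl

/-- One stage of the recursive construction of the wedge: the operators in two consecutive degrees,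
linked by the contraction rule `i_y (α ∧ f) = α(y) f - α ∧ (i_y f)`.
[cite: ChevalleyEilenberg1948, §23 (23.4)] -/
structure WedgeStage (q : ℕ) where
  /-- the wedge `C^q → C^{q+1}` -/
  lo : Cochain R L M q →ₗ[R] Cochain R L M (q + 1)
  /-- the wedge `C^{q+1} → C^{q+2}` -/
  hi : Cochain R L M (q + 1) →ₗ[R] Cochain R L M (q + 2)
  /-- the contraction rule in degree `q + 1` -/
  link : ∀ (y : L) (f : Cochain R L M (q + 1)), ins (q + 1) y (hi f) = α y • f - lo (ins q y f)

/-- Uncurry `wedgeFun` into an operator `C^{q+1} → C^{q+2}`, given the vanishing condition.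
[cite: ChevalleyEilenberg1948, §23 (23.4)] -/
def wedgeOp (q : ℕ) (W : Cochain R L M q →ₗ[R] Cochain R L M (q + 1))
    (h : ∀ (f : Cochain R L M (q + 1)) (y : L), ins q y (wedgeFun α q W f y) = 0) :
    Cochain R L M (q + 1) →ₗ[R] Cochain R L M (q + 2) where
  toFun f := uncurry (wedgeFun α q W f) (uncurry_cond _ (h f))
  map_add' f g := ext_ins fun z => by
    simp only [ins_uncurry, wedgeFun_apply, map_add, smul_add]
    abel
  map_smul' c f := ext_ins fun z => by
    simp only [ins_uncurry, wedgeFun_apply, map_smul, RingHom.id_apply, smul_sub]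
    rw [smul_comm]

/-- `i_y (wedgeOp W f) = α(y) f - W (i_y f)`. [cite: ChevalleyEilenberg1948, §23 (23.4)] -/
@[simp] theorem ins_wedgeOp (q : ℕ) (W : Cochain R L M q →ₗ[R] Cochain R L M (q + 1)) (h)
    (y : L) (f : Cochain R L M (q + 1)) :
    ins (q + 1) y (wedgeOp α q W h f) = α y • f - W (ins q y f) := by
  simp [wedgeOp]

/-- The vanishing condition for the next degree follows from the contraction rule of a stage
(`i_y i_y = 0`). [folklore] -/
theorem wedgeFun_cond_succ {q : ℕ} (S : WedgeStage α (M := M) q) (f : Cochain R L M (q + 2)) (y : L) :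
    ins (q + 1) y (wedgeFun α (q + 1) S.hi f y) = 0 := by
  rw [wedgeFun_apply, map_sub, map_smul, S.link, ins_self, map_zero, sub_zero, sub_self]

/-- The inductive step of the construction. [cite: ChevalleyEilenberg1948, §23 (23.4)] -/
def WedgeStage.succ {q : ℕ} (S : WedgeStage α (M := M) q) : WedgeStage α (M := M) (q + 1) where
  lo := S.hi
  hi := wedgeOp α (q + 1) S.hi (wedgeFun_cond_succ α S)
  link y f := ins_wedgeOp α (q + 1) _ _ y f

/-- The wedge in degree `0`: `(α ∧ f)(y) = α(y) f()`. [cite: ChevalleyEilenberg1948, §24] -/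
def wedgeZero : Cochain R L M 0 →ₗ[R] Cochain R L M 1 where
  toFun f := uncurry (α.smulRight f) (uncurry_cond_zero _)
  map_add' f g := ext_ins fun z => by simp
  map_smul' c f := ext_ins fun z => by
    simp only [ins_uncurry, LinearMap.smulRight_apply, map_smul, RingHom.id_apply]
    rw [smul_comm]

/-- `i_y (α ∧ f) = α(y) f` in degree `0`. [cite: ChevalleyEilenberg1948, §24] -/
@[simp] theorem ins_wedgeZero (y : L) (f : Cochain R L M 0) : ins 0 y (wedgeZero α f) = α y • f := by
  simp [wedgeZero]

/-- The vanishing condition in degree `1`. [folklore] -/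
theorem wedgeFun_cond_zero (f : Cochain R L M 1) (y : L) : ins 0 y (wedgeFun α 0 (wedgeZero α) f y) = 0 := by
  rw [wedgeFun_apply, map_sub, map_smul, ins_wedgeZero, sub_self]

/-- Stage `0` of the wedge. [cite: ChevalleyEilenberg1948, §24] -/
def wedgeStageZero : WedgeStage α (M := M) 0 where
  lo := wedgeZero α
  hi := wedgeOp α 0 (wedgeZero α) (wedgeFun_cond_zero α)
  link y f := ins_wedgeOp α 0 _ _ y f

variable (M) in
/-- All stages, by recursion on the degree. [cite: ChevalleyEilenberg1948, §24] -/
def wedgeStage : (q : ℕ) → WedgeStage α (M := M) q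
  | 0 => wedgeStageZero α
  | q + 1 => (wedgeStage q).succ

variable (M) in
/-- **The wedge `α ∧ f ∈ C^{q+1}(L; M)` of the `1`-form `α : L → R` with `f ∈ C^q(L; M)`**,
`(α ∧ f)(x₀, …, x_q) = ∑ᵢ (-1)ⁱ α(xᵢ) f(x₀, …, x̂ᵢ, …, x_q)`, constructed by recursion on `q` through
`i_y (α ∧ f) = α(y) f - α ∧ (i_y f)`. [cite: ChevalleyEilenberg1948, §24] -/
def wedgeOne (q : ℕ) : Cochain R L M q →ₗ[R] Cochain R L M (q + 1) :=
  (wedgeStage M α q).lo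

/-- The wedge in degree `q + 1` is the upper operator of stage `q` (definitional). [folklore] -/
theorem wedgeOne_succ_eq (q : ℕ) : wedgeOne M α (q + 1) = (wedgeStage M α q).hi := rfl

/-- **Contraction rule in degree `0`**: `i_y (α ∧ f) = α(y) f`. [cite: ChevalleyEilenberg1948, §24] -/
@[simp] theorem ins_wedgeOne_zero (y : L) (f : Cochain R L M 0) : ins 0 y (wedgeOne M α 0 f) = α y • f :=
  ins_wedgeZero α y f

/-- **Contraction rule**: `i_y (α ∧ f) = α(y) f - α ∧ (i_y f)` (defining recursion of the wedge).
[cite: ChevalleyEilenberg1948, §24] -/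
theorem ins_wedgeOne_succ (q : ℕ) (y : L) (f : Cochain R L M (q + 1)) :
    ins (q + 1) y (wedgeOne M α (q + 1) f) = α y • f - wedgeOne M α q (ins q y f) :=
  (wedgeStage M α q).link y f

/-- `(α ∧ f)(y) = α(y) f()` in degree `0`, matrix-literal form. [cite: ChevalleyEilenberg1948, §24] -/
theorem wedgeOne_zero_apply (f : Cochain R L M 0) (y : L) : wedgeOne M α 0 f ![y] = α y • f ![] := by
  have e : wedgeOne M α 0 f ![y] = ins 0 y (wedgeOne M α 0 f) ![] := rfl
  rw [e, ins_wedgeOne_zero, AlternatingMap.smul_apply]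

end Construction

/-! ### Naturality in the coefficients and under changes of Lie pair -/

section Naturality

variable {M' : Type*} [AddCommGroup M'] [Module R M']
  {L' : Type*} [LieRing L'] [LieAlgebra R L']

/-- **The wedge is natural under changes of Lie pair**: `(φ, ψ)^*(α ∧ f) = (α ∘ φ) ∧ (φ, ψ)^* f`.
[folklore] -/
theorem pull_wedgeOne (φ : L' →ₗ⁅R⁆ L) (ψ : M →ₗ[R] M') :
    ∀ (q : ℕ) (f : Cochain R L M q),
      pull M L' φ ψ (q + 1) (wedgeOne M α q f) = wedgeOne M' (α ∘ₗ (φ : L' →ₗ[R] L)) q (pull M L' φ ψ q f)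
  | 0, f => ext_ins fun y => by
    rw [ins_pull, ins_wedgeOne_zero, ins_wedgeOne_zero, map_smul, LinearMap.comp_apply]
    rfl
  | q + 1, f => ext_ins fun y => by
    rw [ins_pull, ins_wedgeOne_succ, ins_wedgeOne_succ, map_sub, map_smul, pull_wedgeOne φ ψ q, ins_pull,
      LinearMap.comp_apply]
    rfl

/-- **The wedge is natural in the coefficients**: `ψ ∘ (α ∧ f) = α ∧ (ψ ∘ f)`. [folklore] -/
theorem post_wedgeOne (ψ : M →ₗ[R] M') (q : ℕ) (f : Cochain R L M q) :
    post L ψ (q + 1) (wedgeOne M α q f) = wedgeOne M' α q (post L ψ q f) :=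
  pull_wedgeOne α LieHom.id ψ q f

/-- A morphism of `L`-modules commutes with the wedge. [folklore] -/
theorem map_wedgeOne [LieRingModule L M] [LieRingModule L M'] (ψ : M →ₗ⁅R,L⁆ M') (q : ℕ) (f : Cochain R L M q) :
    map L ψ (q + 1) (wedgeOne M α q f) = wedgeOne M' α q (map L ψ q f) :=
  post_wedgeOne α (ψ : M →ₗ[R] M') q f

/-- The wedge is linear for extra scalars `A` acting on `M` by `L`-module endomorphisms (e.g. `A = ℂ`
on a complex representation of a real Lie algebra). [folklore] -/
theorem wedgeOne_smul' {A : Type*} [CommRing A] [Module A M] [SMulCommClass R A M] [LieRingModule L M]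
    [LieSMulComm A L M] (a : A) (q : ℕ) (f : Cochain R L M q) :
    wedgeOne M α q (a • f) = a • wedgeOne M α q f := by
  rw [← map_smulHom (R := R) (L := L) a q f, ← map_wedgeOne, map_smulHom]

variable {Γ : Type*} [Group Γ]

/-- **A pair action fixing `α` commutes with the wedge**: `g • (α ∧ f) = α ∧ (g • f)`.
[cite: BorelWallach2000, I §5.1] -/
theorem act_wedgeOne [LieRingModule L M] (A : PairAction R L M Γ) (hα : ∀ (g : Γ) (x : L), α (A.σ g x) = α x)
    (g : Γ) (q : ℕ) (f : Cochain R L M q) :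
    A.act g (q + 1) (wedgeOne M α q f) = wedgeOne M α q (A.act g q f) := by
  have hcomp : α ∘ₗ ((A.σ g⁻¹ : L →ₗ⁅R⁆ L) : L →ₗ[R] L) = α := LinearMap.ext fun x => hα g⁻¹ x
  change pull M L (A.σ g⁻¹) (A.τ g) (q + 1) (wedgeOne M α q f) = wedgeOne M α q (pull M L (A.σ g⁻¹) (A.τ g) q f)
  rw [pull_wedgeOne, hcomp]

end Naturality

/-! ### Cartan calculus: Lie derivative and differential of a wedge -/

section Cartan

variable [LieRingModule L M] [LieModule R L M]

/-- **`θ_x (α ∧ f) = α ∧ θ_x f`** for a `1`-form `α` vanishing on brackets (`θ_x α = -α ∘ ad x = 0`),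
by induction on the degree through `i_y θ_x = θ_x i_y - i_{⁅x,y⁆}`. [cite: BorelWallach2000, I §1.1] -/
theorem lieDer_wedgeOne (hα : ∀ x y : L, α ⁅x, y⁆ = 0) :
    ∀ (q : ℕ) (x : L) (f : Cochain R L M q),
      lieDer R L M (q + 1) x (wedgeOne M α q f) = wedgeOne M α q (lieDer R L M q x f)
  | 0, x, f => ext_ins fun y => by
    rw [ins_lieDer, ins_wedgeOne_zero, ins_wedgeOne_zero, map_smul, ins_wedgeOne_zero, hα, zero_smul, sub_zero]
  | q + 1, x, f => ext_ins fun y => by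
    rw [ins_lieDer, ins_wedgeOne_succ, ins_wedgeOne_succ, map_sub, map_smul, lieDer_wedgeOne hα q x, hα,
      zero_smul, zero_sub, ins_wedgeOne_succ, ins_lieDer, map_sub]
    abel

/-- **`d (α ∧ f) = -(α ∧ d f)`** for a `1`-form `α` vanishing on brackets (`dα = 0`), by induction on
the degree through Cartan's formula `i_y d = θ_y - d i_y`. [cite: BorelWallach2000, I §1.1, §1.3] -/
theorem d_wedgeOne (hα : ∀ x y : L, α ⁅x, y⁆ = 0) :
    ∀ (q : ℕ) (f : Cochain R L M q),
      d R L M (q + 1) (wedgeOne M α q f) = -wedgeOne M α (q + 1) (d R L M q f)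
  | 0, f => ext_ins fun y => by
    rw [ins_d_succ, lieDer_wedgeOne α hα 0, ins_wedgeOne_zero, map_smul, map_neg, ins_wedgeOne_succ,
      ins_d_zero]
    abel
  | q + 1, f => ext_ins fun y => by
    rw [ins_d_succ, lieDer_wedgeOne α hα (q + 1), ins_wedgeOne_succ, map_sub, map_smul, d_wedgeOne hα q,
      map_neg, ins_wedgeOne_succ, ins_d_succ, map_sub]
    abel

/-- Consequently `d (α ∧ f) = α ∧ g` whenever `d f = -g`; in particular **`α ∧ z` is a cocycle for a
cocycle `z`** (`d (α ∧ z) = 0`). [cite: BorelWallach2000, I §1.3] -/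
theorem d_wedgeOne_eq_zero (hα : ∀ x y : L, α ⁅x, y⁆ = 0) (q : ℕ) {f : Cochain R L M q}
    (hf : d R L M q f = 0) : d R L M (q + 1) (wedgeOne M α q f) = 0 := by
  rw [d_wedgeOne α hα, hf, map_zero, neg_zero]

end Cartan

/-! ### Relative and `(𝔤, K)`-cochains -/

section Relative

variable [LieRingModule L M] [LieModule R L M]

/-- **The wedge preserves relative cochains** for `α` vanishing on the subalgebra `K` and on
brackets: `θ_x (α ∧ f) = α ∧ θ_x f = 0` and `i_x (α ∧ f) = α(x) f - α ∧ i_x f = 0` for `x ∈ K`.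
[cite: BorelWallach2000, I §1.3] -/
theorem wedgeOne_mem_rel (K : LieSubalgebra R L) (hαK : ∀ x ∈ K, α x = 0) (hα : ∀ x y : L, α ⁅x, y⁆ = 0) :
    ∀ (q : ℕ) (f : Cochain R L M q), f ∈ (Subcomplex.rel R L M K).carrier q →
      wedgeOne M α q f ∈ (Subcomplex.rel R L M K).carrier (q + 1)
  | 0, f, hf => by
    rw [Subcomplex.mem_rel_zero_iff] at hf
    rw [Subcomplex.mem_rel_succ_iff]
    intro x hx
    refine ⟨?_, ?_⟩
    · rw [lieDer_wedgeOne α hα, hf x hx, map_zero]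
    · rw [ins_wedgeOne_zero, hαK x hx, zero_smul]
  | q + 1, f, hf => by
    rw [Subcomplex.mem_rel_succ_iff] at hf
    rw [Subcomplex.mem_rel_succ_iff]
    intro x hx
    refine ⟨?_, ?_⟩
    · rw [lieDer_wedgeOne α hα, (hf x hx).1, map_zero]
    · rw [ins_wedgeOne_succ, hαK x hx, zero_smul, (hf x hx).2, map_zero, sub_zero]

variable {Γ : Type*} [Group Γ]

/-- **The wedge preserves the `(𝔤, K)`-complex** for `α` vanishing on `𝔨` and on brackets and fixed by
the action of `K` on `L`. [cite: BorelWallach2000, I §1.3, §5.1] -/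
theorem wedgeOne_mem_gK (K : LieSubalgebra R L) (A : PairAction R L M Γ) (hαK : ∀ x ∈ K, α x = 0)
    (hα : ∀ x y : L, α ⁅x, y⁆ = 0) (hαA : ∀ (g : Γ) (x : L), α (A.σ g x) = α x) (q : ℕ) (f : Cochain R L M q)
    (hf : f ∈ (Subcomplex.gK R L M K A).carrier q) :
    wedgeOne M α q f ∈ (Subcomplex.gK R L M K A).carrier (q + 1) := by
  rw [Subcomplex.mem_gK_iff] at hf ⊢
  exact ⟨wedgeOne_mem_rel α K hαK hα q f hf.1, fun g => by rw [act_wedgeOne α A hαA, hf.2 g]⟩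

end Relative

end Literature.Algebra.Lie.ChevalleyEilenberg
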